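import Literature.NumberTheory.LFunctions.DeBruijnPhiComplex

/-!
# Route `JensenPolynomials`, FAR crux `XiWindowZeroFreeRelFar` (B1-rel) — contour tools I: shifting a ray integral to a
horizontal line inside the strip `|Im u| < π/8` (RH-FREE; cell rh-jensen, HUMAN RULING D-0040)

The contour lines for item `stmt-RiemannHypothesis-19465` (theory g7 «steepest-descent», addendum (H2); theory g8
«far-gumbel») evaluate the kernel integral `μ_{2M}F_M(s) = ∫₀^∞ Φ(u)u^{2M}T_M(…)du`
(`WindowEGF.integralRepr`) by moving the ray `[u₁, ∞)` to the horizontal line `Im u = y_s` through the complex saddle,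
`|y_s| ≤ 0.09 < π/8`, where the complex kernel `Φ_C = deBruijnPhiC` is holomorphic and has the strip majorant of
`Literature/NumberTheory/LFunctions/DeBruijnPhiComplex.lean` (p424868). This file supplies the two generic bricks
(«rectShift» of the line cards), with NO reference to `M`, `s` or a normal form:

* §1 `integral_Ioi_eq_integral_Ioi_shift_add` — for `f : ℂ → ℂ` complex-differentiable on the closed half-strip
  `[a, ∞) × [[0, y]]`, integrable on the two horizontal rays and with vertical integrals `∫₀^y f(X + it) dt → 0`
  (`X → ∞`): `∫_{a}^{∞} f(x) dx = ∫_{a}^{∞} f(x + iy) dx + i∫₀^{y} f(a + it) dt` (Cauchy–Goursat on the rectangles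
  `[a, X] × [[0, y]]`, Mathlib `Complex.integral_boundary_rect_eq_zero_of_differentiableOn`, and `X → ∞`); and the
  corollary `…_of_norm_le` where the vanishing of the far side comes from a uniform bound `‖f(X + it)‖ ≤ g(X) → 0`.
* §2 the closed-form STRIP DECAY of the kernel: for `|y| ≤ y₁`, `4y₁ < π/2`, `x ≥ 0`,
  `‖Φ_C(x + iy)‖ ≤ C(y₁)·exp(9x − π cos(4y₁) e^{4x})` with `C(y₁) = Σ_n 5π²(n+1)⁴e^{π}e^{−π cos(4y₁)(n+1)²}`
  (`norm_deBruijnPhiC_le_exp`; the complex twin of the tree's `abs_deBruijnPhi_le`), i.e. super-exponential decay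
  uniform on closed sub-strips — what makes every vertical far side vanish and every shifted ray integrable.

WHAT THIS IS NOT: elementary complex analysis about the positive kernel `Φ`; nothing here bears on the zeros of `ζ`
or the truth of RH. References: Titchmarsh §10.1 [Titchmarsh1986]; Rodgers–Tao 2020 §1 eq. (2) [RodgersTao2020];
Cauchy–Goursat for rectangles (Mathlib).
-/

noncomputable section
-- D-0017: `Summit.RiemannHypothesis.RiemannHypothesis.…` duplicates the namespace BY DESIGN (single-problem summit).
set_option linter.dupNamespace false

namespace Summit.RiemannHypothesis.RiemannHypothesis.Theorems.JensenPolynomials.WindowEGF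

open Literature.NumberTheory.LFunctions MeasureTheory Set Filter Complex
open scoped Topology Real

/-! ## 1. Shifting a ray integral to a horizontal line -/

/-- The closed rectangle `[a, X] × [[0, y]]` lies in the half-strip `[a, ∞) × [[0, y]]`. -/
theorem rect_subset_halfStrip (a X y : ℝ) (haX : a ≤ X) :
    (uIcc a X ×ℂ uIcc 0 y) ⊆ (Ici a ×ℂ uIcc 0 y : Set ℂ) := by
  intro z hz
  refine ⟨?_, hz.2⟩
  have h1 : z.re ∈ uIcc a X := hz.1
  rw [uIcc_of_le haX] at h1
  exact h1.1

/-- **Cauchy–Goursat on the rectangle `[a, X] × [[0, y]]`, ray form.** For `f` complex-differentiable on the half-strip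
`[a, ∞) × [[0, y]]` and `a ≤ X`:
`∫_a^X f(x) dx = ∫_a^X f(x + iy) dx + i∫₀^y f(a + it) dt − i∫₀^y f(X + it) dt`. -/
theorem intervalIntegral_eq_shift_add_vertical {f : ℂ → ℂ} {a y : ℝ}
    (hd : DifferentiableOn ℂ f ((Ici a ×ℂ uIcc 0 y))) {X : ℝ} (haX : a ≤ X) :
    ∫ x in a..X, f x = (∫ x in a..X, f (x + y * I)) + I * (∫ t in (0 : ℝ)..y, f (a + t * I)) -
      I * (∫ t in (0 : ℝ)..y, f (X + t * I)) := by
  have H := Complex.integral_boundary_rect_eq_zero_of_differentiableOn f (a : ℂ) (X + y * I)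
    (hd.mono (by
      have hre : ((X : ℂ) + y * I).re = X := by simp
      have him : ((X : ℂ) + y * I).im = y := by simp
      rw [ofReal_re, ofReal_im, hre, him]
      exact rect_subset_halfStrip a X y haX))
  simp only [ofReal_re, ofReal_im, add_re, mul_re, I_re, mul_zero, ofReal_im, I_im, mul_one, sub_self,
    add_zero, add_im, mul_im, zero_add, ofReal_zero, zero_mul, smul_eq_mul] at H
  linear_combination H

/-- **Shifting a ray integral to a horizontal line (the «rectShift» brick).** Let `f : ℂ → ℂ` be complex-differentiable
on the closed half-strip `[a, ∞) × [[0, y]]`, integrable on the rays `x ↦ f x` and `x ↦ f (x + iy)` over `(a, ∞)`, and let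
the vertical integrals `∫₀^y f(X + it) dt` tend to `0` as `X → ∞`. Then
`∫_{a}^{∞} f(x) dx = ∫_{a}^{∞} f(x + iy) dx + i·∫₀^y f(a + it) dt`. -/
theorem integral_Ioi_eq_integral_Ioi_shift_add {f : ℂ → ℂ} {a y : ℝ}
    (hd : DifferentiableOn ℂ f ((Ici a ×ℂ uIcc 0 y)))
    (h0 : IntegrableOn (fun x : ℝ => f x) (Ioi a))
    (hy : IntegrableOn (fun x : ℝ => f (x + y * I)) (Ioi a))
    (hv : Tendsto (fun X : ℝ => ∫ t in (0 : ℝ)..y, f (X + t * I)) atTop (𝓝 0)) :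
    ∫ x in Ioi a, f x = (∫ x in Ioi a, f (x + y * I)) + I * ∫ t in (0 : ℝ)..y, f (a + t * I) := by
  have hL := intervalIntegral_tendsto_integral_Ioi a h0 tendsto_id
  have hR := intervalIntegral_tendsto_integral_Ioi a hy tendsto_id
  have hlim : Tendsto (fun X : ℝ => (∫ x in a..X, f (x + y * I)) + I * (∫ t in (0 : ℝ)..y, f (a + t * I)) -
      I * (∫ t in (0 : ℝ)..y, f (X + t * I))) atTop
      (𝓝 ((∫ x in Ioi a, f (x + y * I)) + I * (∫ t in (0 : ℝ)..y, f (a + t * I)) - I * 0)) :=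
    (hR.add tendsto_const_nhds).sub (hv.const_mul I)
  rw [mul_zero, sub_zero] at hlim
  refine tendsto_nhds_unique (hL.congr' ?_) hlim
  filter_upwards [eventually_ge_atTop a] with X hX
  exact intervalIntegral_eq_shift_add_vertical hd hX

/-- The vertical integrals vanish at infinity as soon as `‖f(X + it)‖ ≤ g(X)` for `t ∈ [[0, y]]` eventually in `X`, with
`g → 0`. -/
theorem tendsto_verticalIntegral_zero_of_norm_le {f : ℂ → ℂ} {y : ℝ} {g : ℝ → ℝ}
    (hcont : ∀ᶠ X : ℝ in atTop, IntervalIntegrable (fun t : ℝ => f (X + t * I)) volume 0 y)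
    (hbound : ∀ᶠ X : ℝ in atTop, ∀ t ∈ uIcc (0 : ℝ) y, ‖f (X + t * I)‖ ≤ g X)
    (hg : Tendsto g atTop (𝓝 0)) :
    Tendsto (fun X : ℝ => ∫ t in (0 : ℝ)..y, f (X + t * I)) atTop (𝓝 0) := by
  rw [tendsto_zero_iff_norm_tendsto_zero]
  have hg' : Tendsto (fun X => g X * |y - 0|) atTop (𝓝 0) := by
    simpa using hg.mul_const |y - 0|
  refine squeeze_zero' (Eventually.of_forall fun X => norm_nonneg _) ?_ hg'
  filter_upwards [hcont, hbound] with X hcX hbX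
  exact intervalIntegral.norm_integral_le_of_norm_le_const fun t ht => hbX t (by
    rcases le_total 0 y with h | h
    · rw [uIoc_of_le h] at ht; rw [uIcc_of_le h]; exact ⟨ht.1.le, ht.2⟩
    · rw [uIoc_of_ge h] at ht; rw [uIcc_of_ge h]; exact ⟨ht.1.le, ht.2⟩)

/-- **Shift to a horizontal line, decay form.** As `integral_Ioi_eq_integral_Ioi_shift_add`, with the vanishing of the
far vertical side supplied by a uniform bound `‖f(X + it)‖ ≤ g(X)` (`t ∈ [[0, y]]`, `X` large) with `g → 0`. -/
theorem integral_Ioi_eq_integral_Ioi_shift_add_of_norm_le {f : ℂ → ℂ} {a y : ℝ} {g : ℝ → ℝ}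
    (hd : DifferentiableOn ℂ f ((Ici a ×ℂ uIcc 0 y)))
    (h0 : IntegrableOn (fun x : ℝ => f x) (Ioi a))
    (hy : IntegrableOn (fun x : ℝ => f (x + y * I)) (Ioi a))
    (hbound : ∀ᶠ X : ℝ in atTop, ∀ t ∈ uIcc (0 : ℝ) y, ‖f (X + t * I)‖ ≤ g X)
    (hg : Tendsto g atTop (𝓝 0)) :
    ∫ x in Ioi a, f x = (∫ x in Ioi a, f (x + y * I)) + I * ∫ t in (0 : ℝ)..y, f (a + t * I) := by
  refine integral_Ioi_eq_integral_Ioi_shift_add hd h0 hy (tendsto_verticalIntegral_zero_of_norm_le ?_ hbound hg)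
  filter_upwards [eventually_ge_atTop a] with X hX
  refine ContinuousOn.intervalIntegrable ?_
  have hc : ContinuousOn f ((Ici a ×ℂ uIcc 0 y)) := hd.continuousOn
  refine hc.comp (by fun_prop : Continuous fun t : ℝ => (X : ℂ) + t * I).continuousOn ?_
  intro t ht
  refine ⟨?_, ?_⟩
  · show ((X : ℂ) + t * I).re ∈ Ici a
    simpa using hX
  · show ((X : ℂ) + t * I).im ∈ uIcc 0 y
    simpa using ht

/-! ## 2. Super-exponential decay of `Φ_C` on closed sub-strips -/

/-- `cos(4y₁) > 0` for `0 ≤ y₁`, `4y₁ < π/2`. -/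
theorem cos_four_mul_pos_of_lt {y₁ : ℝ} (hy₁ : 0 ≤ y₁) (hy₁' : 4 * y₁ < π / 2) : 0 < Real.cos (4 * y₁) :=
  Real.cos_pos_of_mem_Ioo ⟨by linarith [Real.pi_pos], hy₁'⟩

/-- Termwise strip decay: for `x ≥ 0`, `|y| ≤ y₁`, `4y₁ ≤ π/2`, with `c₁ = cos(4y₁)`,
`‖Φ_{C,n}(x + iy)‖ ≤ 5π²(n+1)⁴e^{πc₁}e^{−πc₁(n+1)²} · exp(9x − πc₁e^{4x})`. -/
theorem norm_deBruijnPhiSummandC_le_exp (n : ℕ) {x y y₁ : ℝ} (hx : 0 ≤ x) (hy : |y| ≤ y₁)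
    (hy₁' : 4 * y₁ ≤ π / 2) :
    ‖deBruijnPhiSummandC n (x + y * I)‖ ≤
      (5 * π ^ 2 * ((n : ℝ) + 1) ^ 4 * (Real.exp (π * Real.cos (4 * y₁)) *
          Real.exp (-(π * Real.cos (4 * y₁) * ((n : ℝ) + 1) ^ 2)))) *
        Real.exp (9 * x - π * Real.cos (4 * y₁) * Real.exp (4 * x)) := by
  set m : ℝ := (n : ℝ) + 1 with hm
  set c₁ : ℝ := Real.cos (4 * y₁) with hc₁
  set s : ℝ := Real.exp (4 * x) with hs
  have hm1 : (1 : ℝ) ≤ m := by simp [hm]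
  have hs1 : 1 ≤ s := Real.one_le_exp (by linarith)
  have hy₁ : 0 ≤ y₁ := (abs_nonneg y).trans hy
  have hc₁0 : 0 ≤ c₁ := Real.cos_nonneg_of_mem_Icc ⟨by linarith [Real.pi_pos], hy₁'⟩
  -- the strip majorant, then monotonicity in `y`
  have h1 : ‖deBruijnPhiSummandC n (x + y * I)‖ ≤ deBruijnPhiStripMajorant x y n := by
    have := norm_deBruijnPhiSummandC_le n (x + y * I)
    simpa using this
  have h2 := deBruijnPhiStripMajorant_le (le_refl x) (le_refl x) hy hy₁' n
  -- polynomial factor: `2π²m⁴e^{9x} + 3πm²e^{5x} ≤ 5π²m⁴e^{9x}`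
  have h5 : Real.exp (5 * x) ≤ Real.exp (9 * x) := Real.exp_monotone (by linarith)
  have hm2 : m ^ 2 ≤ m ^ 4 := by
    have : 1 ≤ m ^ 2 := by nlinarith
    nlinarith
  have hπ : (3 : ℝ) < π := Real.pi_gt_three
  have hpoly : 2 * π ^ 2 * m ^ 4 * Real.exp (9 * x) + 3 * π * m ^ 2 * Real.exp (5 * x) ≤
      5 * π ^ 2 * m ^ 4 * Real.exp (9 * x) := by
    have : 3 * π * m ^ 2 * Real.exp (5 * x) ≤ 3 * π ^ 2 * m ^ 4 * Real.exp (9 * x) := by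
      have hπ1 : π ≤ π ^ 2 := by nlinarith
      gcongr
    linarith
  -- Gaussian factor: `exp(−π m² s c₁) ≤ exp(π c₁) exp(−π c₁ m²) · exp(−π c₁ s)`
  have hgauss : Real.exp (-(π * m ^ 2 * s * c₁)) ≤
      Real.exp (π * c₁) * Real.exp (-(π * c₁ * m ^ 2)) * Real.exp (-(π * c₁ * s)) := by
    rw [← Real.exp_add, ← Real.exp_add]
    apply Real.exp_monotone
    have : 0 ≤ π * c₁ * ((m ^ 2 - 1) * (s - 1)) := by
      have := Real.pi_pos.le
      have h' : 0 ≤ (m ^ 2 - 1) * (s - 1) := mul_nonneg (by nlinarith) (by linarith)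
      positivity
    nlinarith
  calc ‖deBruijnPhiSummandC n (x + y * I)‖
      ≤ (2 * π ^ 2 * m ^ 4 * Real.exp (9 * x) + 3 * π * m ^ 2 * Real.exp (5 * x)) *
          Real.exp (-(π * m ^ 2 * Real.exp (4 * x) * Real.cos (4 * y₁))) := h1.trans h2
    _ ≤ (5 * π ^ 2 * m ^ 4 * Real.exp (9 * x)) *
          (Real.exp (π * c₁) * Real.exp (-(π * c₁ * m ^ 2)) * Real.exp (-(π * c₁ * s))) := by
        rw [← hs, ← hc₁]
        exact mul_le_mul hpoly hgauss (Real.exp_pos _).le (by positivity)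
    _ = (5 * π ^ 2 * m ^ 4 * (Real.exp (π * c₁) * Real.exp (-(π * c₁ * m ^ 2)))) *
          Real.exp (9 * x - π * c₁ * s) := by
        rw [sub_eq_add_neg, Real.exp_add (9 * x)]; ring

/-- The constant `C(y₁) = Σ_n 5π²(n+1)⁴e^{πc₁}e^{−πc₁(n+1)²}`, `c₁ = cos(4y₁) > 0`, is a convergent series. -/
theorem summable_stripDecayConst {y₁ : ℝ} (hy₁ : 0 ≤ y₁) (hy₁' : 4 * y₁ < π / 2) :
    Summable fun n : ℕ => 5 * π ^ 2 * ((n : ℝ) + 1) ^ 4 * (Real.exp (π * Real.cos (4 * y₁)) *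
      Real.exp (-(π * Real.cos (4 * y₁) * ((n : ℝ) + 1) ^ 2))) := by
  have hc := cos_four_mul_pos_of_lt hy₁ hy₁'
  have := (summable_succ_pow_mul_exp_neg_mul_sq 4 (mul_pos Real.pi_pos hc)).mul_left
    (5 * π ^ 2 * Real.exp (π * Real.cos (4 * y₁)))
  refine this.congr fun n => ?_
  ring

/-- **Strip decay of the complex kernel, explicit form.** For `x ≥ 0`, `|y| ≤ y₁`, `0 ≤ y₁`, `4y₁ < π/2`:
`‖Φ_C(x + iy)‖ ≤ C(y₁)·exp(9x − π cos(4y₁) e^{4x})`, `C(y₁) = Σ_n 5π²(n+1)⁴e^{π cos 4y₁}e^{−π cos(4y₁)(n+1)²}`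
(the complex twin of `abs_deBruijnPhi_le`). -/
theorem norm_deBruijnPhiC_le_tsum_mul_exp {x y y₁ : ℝ} (hx : 0 ≤ x) (hy : |y| ≤ y₁) (hy₁' : 4 * y₁ < π / 2) :
    ‖deBruijnPhiC (x + y * I)‖ ≤
      (∑' n : ℕ, 5 * π ^ 2 * ((n : ℝ) + 1) ^ 4 * (Real.exp (π * Real.cos (4 * y₁)) *
          Real.exp (-(π * Real.cos (4 * y₁) * ((n : ℝ) + 1) ^ 2)))) *
        Real.exp (9 * x - π * Real.cos (4 * y₁) * Real.exp (4 * x)) := by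
  have hy₁ : 0 ≤ y₁ := (abs_nonneg y).trans hy
  have hyy : |y| < π / 8 := lt_of_le_of_lt hy (by linarith)
  have him : ((x : ℂ) + y * I).im = y := by simp
  have hsum := summable_norm_deBruijnPhiSummandC (u := x + y * I) (by rw [him]; exact hyy)
  unfold deBruijnPhiC
  refine (norm_tsum_le_tsum_norm hsum).trans ?_
  rw [← tsum_mul_right]
  exact hsum.tsum_le_tsum (fun n => norm_deBruijnPhiSummandC_le_exp n hx hy hy₁'.le)
    ((summable_stripDecayConst hy₁ hy₁').mul_right _)

/-- **Strip decay of the complex kernel.** For `0 ≤ y₁`, `4y₁ < π/2` there is `C > 0` with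
`‖Φ_C(x + iy)‖ ≤ C·exp(9x − π cos(4y₁) e^{4x})` for all `x ≥ 0`, `|y| ≤ y₁` — super-exponential decay, uniform on the
closed sub-strip (it makes the far vertical sides of the contour rectangles vanish and the shifted rays integrable). -/
theorem norm_deBruijnPhiC_le_exp {y₁ : ℝ} (hy₁ : 0 ≤ y₁) (hy₁' : 4 * y₁ < π / 2) :
    ∃ C : ℝ, 0 < C ∧ ∀ x y : ℝ, 0 ≤ x → |y| ≤ y₁ →
      ‖deBruijnPhiC (x + y * I)‖ ≤ C * Real.exp (9 * x - π * Real.cos (4 * y₁) * Real.exp (4 * x)) := by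
  refine ⟨_, ?_, fun x y hx hy => norm_deBruijnPhiC_le_tsum_mul_exp hx hy hy₁'⟩
  refine (summable_stripDecayConst hy₁ hy₁').tsum_pos (fun n => by positivity) 0 (by positivity)

/-- The decay wins against any exponential: for `c > 0` and every `K`,
`exp(K·x) · exp(9x − c·e^{4x}) → 0` as `x → ∞`. -/
theorem tendsto_exp_mul_mul_exp_sub_atTop {c : ℝ} (hc : 0 < c) (K : ℝ) :
    Tendsto (fun x : ℝ => Real.exp (K * x) * Real.exp (9 * x - c * Real.exp (4 * x))) atTop (𝓝 0) := by
  have hE : ∀ᶠ x : ℝ in atTop, K * x + (9 * x - c * Real.exp (4 * x)) ≤ -x := by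
    filter_upwards [eventually_ge_atTop (0 : ℝ), eventually_ge_atTop (|K + 10| / (8 * c) + 1)] with x hx0 hx1
    have hexp : 1 + 4 * x + 8 * x ^ 2 ≤ Real.exp (4 * x) := by
      have := Real.quadratic_le_exp_of_nonneg (by linarith : (0 : ℝ) ≤ 4 * x)
      nlinarith
    have h8 : |K + 10| ≤ 8 * c * x := by
      have : |K + 10| / (8 * c) ≤ x := by linarith
      rwa [div_le_iff₀ (by positivity), mul_comm] at this
      |> fun h => by linarith [h]
    have hK : (K + 10) * x ≤ 8 * c * x ^ 2 := by
      calc (K + 10) * x ≤ |K + 10| * x := by gcongr; exact le_abs_self _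
        _ ≤ (8 * c * x) * x := by gcongr
        _ = 8 * c * x ^ 2 := by ring
    nlinarith
  have hlim : Tendsto (fun x : ℝ => K * x + (9 * x - c * Real.exp (4 * x))) atTop atBot :=
    tendsto_atBot_mono' atTop hE tendsto_neg_atTop_atBot
  have := Real.tendsto_exp_atBot.comp hlim
  refine this.congr fun x => ?_
  simp [Function.comp, Real.exp_add]

/-! ## 3. The packaged shift for `Φ_C`-weighted integrands -/

/-- Points of the closed half-strip `[a, ∞) × [[0, y]]` with `|y| < π/8` lie in the open strip `|Im u| < π/8`. -/
theorem abs_im_lt_of_mem_halfStrip {a y : ℝ} (hy : |y| < π / 8) {z : ℂ} (hz : z ∈ (Ici a ×ℂ uIcc 0 y : Set ℂ)) :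
    |z.im| < π / 8 := by
  have h : z.im ∈ uIcc 0 y := hz.2
  rcases le_total 0 y with h0 | h0
  · rw [uIcc_of_le h0] at h
    rw [abs_lt]; rw [abs_lt] at hy; constructor <;> linarith [h.1, h.2]
  · rw [uIcc_of_ge h0] at h
    rw [abs_lt]; rw [abs_lt] at hy; constructor <;> linarith [h.1, h.2]

/-- `x + it` lies in the half-strip `[a, ∞) × [[0, y]]` when `a ≤ x` and `t ∈ [[0, y]]`. -/
theorem mk_mem_halfStrip {a y x t : ℝ} (hx : a ≤ x) (ht : t ∈ uIcc 0 y) :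
    ((x : ℂ) + t * I) ∈ (Ici a ×ℂ uIcc 0 y : Set ℂ) := by
  refine ⟨?_, ?_⟩
  · show ((x : ℂ) + t * I).re ∈ Ici a
    simpa using hx
  · show ((x : ℂ) + t * I).im ∈ uIcc 0 y
    simpa using ht

/-- A continuous `h : ℝ → ℝ` on `[a, ∞)` with `h(x)·eˣ → 0` is integrable on `(a, ∞)`. -/
theorem integrableOn_Ioi_of_tendsto_mul_exp {h : ℝ → ℝ} {a : ℝ} (hc : ContinuousOn h (Ici a))
    (ht : Tendsto (fun x => h x * Real.exp x) atTop (𝓝 0)) : IntegrableOn h (Ioi a) := by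
  refine integrable_of_isBigO_exp_neg one_pos hc (Asymptotics.IsLittleO.isBigO ?_)
  refine Asymptotics.isLittleO_of_tendsto' (Eventually.of_forall fun x hx => ?_) ?_
  · exact absurd hx (Real.exp_pos _).ne'
  · refine ht.congr fun x => ?_
    rw [neg_mul, one_mul, Real.exp_neg, div_inv_eq_mul]

/-- **The «rectShift» brick for `Φ_C`-weighted integrands.** Let `0 ≤ a`, `|y| ≤ y₁`, `4y₁ < π/2`, and let `G` be
complex-differentiable on the closed half-strip `[a, ∞) × [[0, y]]` with an exponential bound `‖G(x + it)‖ ≤ B·e^{Kx}`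
there. Then the three integrals below converge and
`∫_{a}^{∞} Φ(x)G(x) dx = ∫_{a}^{∞} Φ_C(x + iy)G(x + iy) dx + i∫₀^{y} Φ_C(a + it)G(a + it) dt`
(`Φ_C = deBruijnPhiC`, equal to `deBruijnPhi` on the real axis). -/
theorem integral_Ioi_deBruijnPhiC_mul_eq_shift_add {G : ℂ → ℂ} {a y y₁ B K : ℝ} (ha : 0 ≤ a) (hy : |y| ≤ y₁)
    (hy₁' : 4 * y₁ < π / 2) (hG : DifferentiableOn ℂ G (Ici a ×ℂ uIcc 0 y))
    (hGb : ∀ x t : ℝ, a ≤ x → t ∈ uIcc 0 y → ‖G (x + t * I)‖ ≤ B * Real.exp (K * x)) :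
    IntegrableOn (fun x : ℝ => deBruijnPhiC x * G x) (Ioi a) ∧
    IntegrableOn (fun x : ℝ => deBruijnPhiC (x + y * I) * G (x + y * I)) (Ioi a) ∧
    ∫ x in Ioi a, deBruijnPhiC x * G x =
      (∫ x in Ioi a, deBruijnPhiC (x + y * I) * G (x + y * I)) +
        I * ∫ t in (0 : ℝ)..y, deBruijnPhiC (a + t * I) * G (a + t * I) := by
  have hy₁ : 0 ≤ y₁ := (abs_nonneg y).trans hy
  have hyπ : |y| < π / 8 := lt_of_le_of_lt hy (by linarith)
  obtain ⟨C, hCpos, hC⟩ := norm_deBruijnPhiC_le_exp hy₁ hy₁'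
  set c₁ : ℝ := Real.cos (4 * y₁) with hc₁
  have hc₁pos : 0 < c₁ := cos_four_mul_pos_of_lt hy₁ hy₁'
  set F : ℂ → ℂ := fun u => deBruijnPhiC u * G u with hF
  -- differentiability of the product on the half-strip
  have hFd : DifferentiableOn ℂ F (Ici a ×ℂ uIcc 0 y) :=
    (differentiableOn_deBruijnPhiC.mono fun z hz => abs_im_lt_of_mem_halfStrip hyπ hz).mul hG
  have hFc : ContinuousOn F (Ici a ×ℂ uIcc 0 y) := hFd.continuousOn
  -- the uniform bound on the half-strip
  have hc : 0 < π * c₁ := mul_pos Real.pi_pos hc₁pos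
  have hFb : ∀ x t : ℝ, a ≤ x → t ∈ uIcc 0 y →
      ‖F (x + t * I)‖ ≤ C * B * (Real.exp (K * x) * Real.exp (9 * x - (π * c₁) * Real.exp (4 * x))) := by
    intro x t hx ht
    have hx0 : 0 ≤ x := ha.trans hx
    have ht' : |t| ≤ y₁ := by
      refine le_trans ?_ hy
      rcases le_total 0 y with h0 | h0
      · rw [uIcc_of_le h0] at ht; rw [abs_le]; constructor <;> linarith [ht.1, ht.2, abs_nonneg y, le_abs_self y]
      · rw [uIcc_of_ge h0] at ht; rw [abs_le]; constructor <;> linarith [ht.1, ht.2, neg_abs_le y]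
    have h1 := hC x t hx0 ht'
    have h2 := hGb x t hx ht
    show ‖deBruijnPhiC (x + t * I) * G (x + t * I)‖ ≤ _
    rw [norm_mul]
    calc ‖deBruijnPhiC (x + t * I)‖ * ‖G (x + t * I)‖
        ≤ (C * Real.exp (9 * x - π * c₁ * Real.exp (4 * x))) * (B * Real.exp (K * x)) :=
          mul_le_mul h1 h2 (norm_nonneg _) (by positivity)
      _ = C * B * (Real.exp (K * x) * Real.exp (9 * x - (π * c₁) * Real.exp (4 * x))) := by ring
  -- integrability on a horizontal ray `t ∈ [[0, y]]`
  have hint : ∀ t : ℝ, t ∈ uIcc 0 y → IntegrableOn (fun x : ℝ => F (x + t * I)) (Ioi a) := by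
    intro t ht
    have hcont : ContinuousOn (fun x : ℝ => F (x + t * I)) (Ici a) :=
      hFc.comp (by fun_prop : Continuous fun x : ℝ => (x : ℂ) + t * I).continuousOn
        fun x hx => mk_mem_halfStrip hx ht
    have hdom : IntegrableOn (fun x : ℝ => C * B * (Real.exp (K * x) * Real.exp (9 * x - (π * c₁) * Real.exp (4 * x))))
        (Ioi a) := by
      refine integrableOn_Ioi_of_tendsto_mul_exp (by fun_prop) ?_
      have h := (tendsto_exp_mul_mul_exp_sub_atTop hc (K + 1)).const_mul (C * B)
      rw [mul_zero] at h
      refine h.congr fun x => ?_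
      have : Real.exp ((K + 1) * x) = Real.exp (K * x) * Real.exp x := by
        rw [← Real.exp_add]; ring_nf
      rw [this]; ring
    refine hdom.mono' (hcont.aestronglyMeasurable measurableSet_Ici |>.mono_set Ioi_subset_Ici_self) ?_
    refine (ae_restrict_iff' measurableSet_Ioi).2 (Eventually.of_forall fun x hx => ?_)
    exact hFb x t (le_of_lt hx) ht
  have h0 : IntegrableOn (fun x : ℝ => F x) (Ioi a) := by
    have := hint 0 (by simp)
    simpa using this
  have hyI : IntegrableOn (fun x : ℝ => F (x + y * I)) (Ioi a) := hint y (by simp)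
  refine ⟨h0, hyI, ?_⟩
  refine integral_Ioi_eq_integral_Ioi_shift_add_of_norm_le
    (g := fun X => C * B * (Real.exp (K * X) * Real.exp (9 * X - (π * c₁) * Real.exp (4 * X)))) hFd h0 hyI ?_ ?_
  · filter_upwards [eventually_ge_atTop a] with X hX
    exact fun t ht => hFb X t hX ht
  · have h := (tendsto_exp_mul_mul_exp_sub_atTop hc K).const_mul (C * B)
    rw [mul_zero] at h
    exact h

end Summit.RiemannHypothesis.RiemannHypothesis.Theorems.JensenPolynomials.WindowEGF

end
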